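import Literature.MathematicalPhysics.QuantumFieldTheory.Balaban1983to89.B8LeafModelZd3
import Literature.MathematicalPhysics.QuantumFieldTheory.Balaban1983to89.B8Ineq166Univ

/-!
# `Balaban1983to89.B8LeafModelZd3Thm2` — [Balaban1985RegularSpaces] THEOREM 2 (p. 83) AS THE ABSTRACT LEAF `B8.Thm2Printed` ON THE
# `Ω₀ = ℤᵈ` SUB-FAMILY OF THE `GFData3` PROTOTYPE `zdGF3` — p. 88 «Of course this theorem implies Theorem 2» ASSEMBLED: Theorem 4 at the
# (1.65)-shifted pair, the (1.42) lemma at the original `α₁`, Proposition 3 at `α₂ = c⋆″`, and (1.66)₀ from (1.33)–(1.35) on all bonds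

statement-level skeleton of published theorems with citation tags; proofs where landed; nothing here is a claim about the
Yang–Mills mass gap

PDF held: `paper:balaban1985-cmp99-regular-spaces-gauge-fixing` (journal page = PDF page + 74); pp. 82–83 (Theorem 2, (1.33)–(1.39)), pp. 86–88
((1.59)–(1.67), Proposition 3, Theorem 4, «Of course this theorem implies Theorem 2»), p. 77 («we admit … Ω_j = T_η»).

WHY THIS FILE (cell `pub-ymgap`, seat `pub-ymgap-dag-n05-a` g5, KNIT seat of DAG node N05 = [B8]; count-neutral).  The leaf conjunct
`t2 := B8.Thm2Printed fam`.  `B8LeafKnitRS.b8LeafRS_knit` DERIVES it from `t4` + `p3` by `B8.thm2_of_thm4_prop3`, whose carrier law `h137`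
(«(1.35) + (1.29) + (1.62) ⇒ (1.37)») is not available on honest carriers (the (1.42) lemma needs (1.33)/(1.34)); and on the prototype indexed by
ALL of `ZdIdx` the sentence is FALSE (`B8LeafModelZd3Boundary.not_thm2Printed_zdGF3`, the Ω₀-boundary layer).  Here it is PROVED on the
sub-family `{i // i.Ω 0 = univ}` (print p. 77 admits `Ω_j = T_η`; there the gauge group is print's full one and the boundary layer is empty),
as print says (p. 88): Theorem 4 (`thm4Printed_zd3_of_HFP₄`) at the pair `(α₀, α″)`, `α″ := 11d²(α₀ + α₁) + α₁` — so that `B₁′(α₀ + α″) =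
5dLB₀(1 + 11d²)(α₀ + α₁)` — its hypothesis (1.66) served by (1.35) and **`B8Ineq166Univ.norm_pert_sub_one_le_univ`** ((1.65) on all bonds);
(1.37) at the ORIGINAL `α₁` by the (1.42) lemma `B8Eq142KLevelLocal.H42_of_inAx` on the canonical exponent `mlogCfg` of the gauge-fixed field;
(1.36)/(1.39) by Proposition 3 (`prop3Printed_zd3`) at `α₂ := c⋆″ = 5dLB₀(α₀ + α″)`, its (1.61) from the window of `B8Thm4Windows.thm4_windows`;
uniqueness = Theorem 4's (a `u′` with (1.36) at `B₁ = 5dLB₀(1 + 11d²)` has (1.62) at `B₁′(α₀ + α″)`, and (1.37) is monotone in `α₁`).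
Constants: `B₁ = 5dLB₀(1 + 11d²)`, `B₂ = 5dL·B₀β·(1 + 11d²)`, ONE threshold `c₁(d, L, B₀, B₀′, providers)`.

WHAT IS PROVED (kernel, 0 sorry, theorems only, no new definition — the sub-family is a subtype):
**`thm2Printed_zd3_univ : B8.Thm2Printed (fun i : {i : ZdIdx d L // i.Ω 0 = Set.univ} => (zdGF3 𝔸 L β len i.1).toGFData)`** modulo the
member-wise sockets of t4 (`SockHFP₀`/`SockHFP`/`SockH59`/`SockP5u`) and p3 (`SockB9P3`), each below its own threshold.

HONEST SCOPE.  An assembly BY NAME of landed instances and lit-balaban's (1.65); nothing of Propositions 3/5, (1.42), (1.59), (1.65) is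
re-proved; the sockets (Prop. 5 fixed point / uniqueness, [4] Thm 3.3 in both frames) remain hypotheses quantified over ALL members of `ZdIdx`
(a fortiori over the sub-family); `≤` for print's `<`; `E j = SideTouches (Ω j)`.  Count-neutral; N05 NOT discharged; nothing continuum / ℝ⁴ /
OS / mass-gap / Clay.  Unit `pub-ymgap-dag-n05-a` (g5), 2026-08-26.
-/

noncomputable section

open NormedSpace

namespace Literature.MathematicalPhysics.QuantumFieldTheory.Balaban1983to89.B8LeafModelZd3Thm2

open Complex (I)
open MatrixLog B7Prop1Explicit B7Prop2Explicit B7Prop1Local B7Eq92Concrete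
open B7Prop2Explicit (C0 c2')
open B7Prop3Flat (c3)
open B8Ineq132 (covDerivFwd InAk BondTouches)
open B8Eq119TwistedAxial (Restr129 InAx)
open B8Eq184Proof (gaugeExp cfgExp)
open B8Lemma1NonAbelian (mulCfg)
open B8Eq140Level (SideTouches)
open B8Thm2LogB (blockTop)
open B8Ineq130 (tlo thi)
open B8Eq138LandauZd (IsLandau138W logCfg)
open B8Prop3GaugeFixedKLevel (mem_unitaryUnits_of_mgauge_eq mulCfg_eq_gaugeAct_of_mgauge_eq)
open B8Thm4AtLandau138 (mgauge_mgauge_inv)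
open B8Thm4Windows (thm4_windows thm4_windows_extra)
open B8LeafModelZd (SockH59 SockP5u ZdIdx)
open B8LeafModelZdOfHFP (SockHFP₀ SockHFP)
open B8LeafModelZd3 (mlogCfg mlogCfg_spec zdGF3 SockB9P3 thm4Printed_zd3_of_HFP₄ prop3Printed_zd3)
open B8Ineq166Univ (norm_pert_sub_one_le_univ)

-- `Site` alone could resolve to the torus sites of `Setup.lean`; re-export the `ℤ^d` sites of `B7Prop1Explicit`.
export B7Prop1Explicit (Site)

variable {d : ℕ}

section Thm2

variable {𝔸 : Type} [CStarAlgebra 𝔸] [Nontrivial 𝔸]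

/-- **`B8.Thm2Printed` ON THE `Ω₀ = ℤᵈ` SUB-FAMILY OF `zdGF3`** (Theorem 2, p. 83, via p. 88 «Of course this theorem implies Theorem 2»), for
`d, L ≥ 2`, `B₀ > 0` with `2 ≤ 5dLB₀`, `B₀′, B₀β > 0`, Prop. 5's uniqueness radius `cu > 0`, any Hölder data `β, len`, MODULO the member-wise
sockets of Theorem 4 (`SockHFP₀`, `SockHFP`, `SockH59`, `SockP5u`) and of Proposition 3 (`SockB9P3`), each below its own positive threshold.
Constants `B₁ = 5dLB₀(1 + 11d²)`, `B₂ = 5dL·B₀β·(1 + 11d²)`.  See the module docstring for the assembly.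
[cite: Balaban1985RegularSpaces, Thm 2 p.83, Thm 4 p.88 («Of course this theorem implies Theorem 2»), Prop. 3 p.87, (1.65)–(1.66) p.87, (1.42) p.83, (1.36)–(1.39) p.82] -/
theorem thm2Printed_zd3_univ (hd2 : 2 ≤ d) {L : ℕ} (hL : 2 ≤ L) {β : ℝ} {len : Site d → ℝ}
    {B₀ B₀' B₀β cu cF₀ cF c59 cu' cB9 : ℝ} (hB₀ : 0 < B₀) (hB₀' : 0 < B₀') (hB₀β : 0 < B₀β) (hB : 2 ≤ 5 * (d : ℝ) * L * B₀)
    (hcu : 0 < cu) (hcF₀ : 0 < cF₀) (hcF : 0 < cF) (hc59 : 0 < c59) (hcu' : 0 < cu') (hcB9 : 0 < cB9)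
    (SHFP₀ : ∀ i : ZdIdx d L, SockHFP₀ (𝔸 := 𝔸) L B₀ B₀' cF₀ i.η i.k i.Ω i.Λs)
    (SHFP : ∀ i : ZdIdx d L, SockHFP (𝔸 := 𝔸) L B₀ B₀' cF i.η i.k i.Ω i.Λs)
    (SH59 : ∀ i : ZdIdx d L, SockH59 (𝔸 := 𝔸) L B₀ B₀' c59 i.η i.k i.Ω i.Λs i.Λb)
    (SP5u : ∀ i : ZdIdx d L, SockP5u (𝔸 := 𝔸) L cu' cu i.η i.k i.Ω i.Λs)
    (SB9 : ∀ i : ZdIdx d L, SockB9P3 (𝔸 := 𝔸) L B₀ B₀β cB9 β len i.η i.k i.Ω i.Λs i.Λb) :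
    B8.Thm2Printed (fun i : {i : ZdIdx d L // i.Ω 0 = Set.univ} => (zdGF3 𝔸 L β len i.1).toGFData) := by
  have hL1 : 1 ≤ L := le_trans (by norm_num) hL
  have hd1 : 1 ≤ d := le_trans (by norm_num) hd2
  have hL' : (1 : ℝ) ≤ L := by exact_mod_cast hL1
  have hd' : (1 : ℝ) ≤ d := by exact_mod_cast hd1
  -- the two instances, the windows
  obtain ⟨c4, hc4, H4⟩ := thm4Printed_zd3_of_HFP₄ (𝔸 := 𝔸) (β := β) (len := len) hd2 hL hB₀ hB₀' hB hcu hcF₀ hcF hc59 hcu'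
    SHFP₀ SHFP SH59 SP5u
  let inp : B8.B9Inputs := ⟨B₀, B₀', hB₀, hB₀'⟩
  obtain ⟨c3, hc3, H3⟩ := prop3Printed_zd3 (𝔸 := 𝔸) hd2 hL inp (B₀β := B₀β) (C₂ := 2097152 * ((d : ℝ) + 1) ^ 2) hB₀β.le le_rfl
    hcB9 β len SB9
  obtain ⟨cw, hcw, hw⟩ := thm4_windows hd1 hL1 hB₀ hB₀' hB
  obtain ⟨cw', hcw', hw'⟩ := thm4_windows_extra (d := d) hL1
  -- constants
  set D : ℝ := 1 + 11 * (d : ℝ) ^ 2 with hD_def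
  have hD1 : 1 ≤ D := le_add_of_nonneg_right (by positivity)
  have hD0 : 0 < D := lt_of_lt_of_le one_pos hD1
  have hDne : D ≠ 0 := hD0.ne'
  have hK₁ : 0 < 5 * (d : ℝ) * L * B₀ := by positivity
  have hK₂ : 0 < 5 * (d : ℝ) * L * B₀β := by positivity
  set B₁ : ℝ := 5 * (d : ℝ) * L * B₀ * D with hB₁_def
  set B₂ : ℝ := 5 * (d : ℝ) * L * B₀β * D with hB₂_def
  have hB₁0 : 0 < B₁ := mul_pos hK₁ hD0
  have hB₂0 : 0 < B₂ := mul_pos hK₂ hD0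
  have hK₁D : 0 < 5 * (d : ℝ) * L * B₀ * D := mul_pos hK₁ hD0
  have hK₁Dne : 5 * (d : ℝ) * L * B₀ * D ≠ 0 := hK₁D.ne'
  -- the threshold: the shifted pair must fit every window; Prop 3's three smallness conditions; the (1.65) window
  set cT : ℝ := min (min (c4 / D) (min (cw / D) (cw' / D)))
    (min (min (c3 / D) (c3 / (5 * (d : ℝ) * L * B₀ * D))) (1 / (6 * D))) with hcT_def
  have hcT : 0 < cT :=
    lt_min (lt_min (div_pos hc4 hD0) (lt_min (div_pos hcw hD0) (div_pos hcw' hD0)))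
      (lt_min (lt_min (div_pos hc3 hD0) (div_pos hc3 hK₁D)) (by positivity))
  refine ⟨B₁, B₂, cT, hB₁0, hB₂0, hcT, ?_⟩
  intro i α₀ α₁ hα₀ hα₁ hs U₀ P hInA hReg hInAAx havg
  have hS0 : 0 < α₀ + α₁ := add_pos hα₀ hα₁
  -- unpack the thresholds
  have hle : ∀ {c : ℝ}, cT ≤ c / D → D * (α₀ + α₁) ≤ c := by
    intro c hc
    have h1 : α₀ + α₁ ≤ c / D := hs.trans hc
    calc D * (α₀ + α₁) ≤ D * (c / D) := mul_le_mul_of_nonneg_left h1 hD0.le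
      _ = c := by field_simp
  have hs4 : D * (α₀ + α₁) ≤ c4 := hle ((min_le_left _ _).trans (min_le_left _ _))
  have hsw : D * (α₀ + α₁) ≤ cw := hle ((min_le_left _ _).trans ((min_le_right _ _).trans (min_le_left _ _)))
  have hsw' : D * (α₀ + α₁) ≤ cw' := hle ((min_le_left _ _).trans ((min_le_right _ _).trans (min_le_right _ _)))
  have hs3 : D * (α₀ + α₁) ≤ c3 := hle ((min_le_right _ _).trans ((min_le_left _ _).trans (min_le_left _ _)))
  have hs3' : 5 * (d : ℝ) * L * B₀ * D * (α₀ + α₁) ≤ c3 := by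
    have h1 : α₀ + α₁ ≤ c3 / (5 * (d : ℝ) * L * B₀ * D) :=
      hs.trans ((min_le_right _ _).trans ((min_le_left _ _).trans (min_le_right _ _)))
    calc 5 * (d : ℝ) * L * B₀ * D * (α₀ + α₁) ≤ 5 * (d : ℝ) * L * B₀ * D * (c3 / (5 * (d : ℝ) * L * B₀ * D)) :=
        mul_le_mul_of_nonneg_left h1 hK₁D.le
      _ = c3 := by field_simp
  have hs6 : D * (α₀ + α₁) ≤ 1 / 6 := by
    have h1 : α₀ + α₁ ≤ 1 / (6 * D) := hs.trans ((min_le_right _ _).trans (min_le_right _ _))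
    calc D * (α₀ + α₁) ≤ D * (1 / (6 * D)) := mul_le_mul_of_nonneg_left h1 hD0.le
      _ = 1 / 6 := by field_simp
  -- the shifted pair `(α₀, α″)`
  set α'' : ℝ := 11 * (d : ℝ) ^ 2 * (α₀ + α₁) + α₁ with hα''_def
  have h11 : 0 ≤ 11 * (d : ℝ) ^ 2 * (α₀ + α₁) := by positivity
  have h11' : 0 ≤ 11 * (d : ℝ) ^ 2 * α₁ := by positivity
  have hα'' : 0 < α'' := by rw [hα''_def]; linarith only [h11, hα₁]
  have hsum : α₀ + α'' = D * (α₀ + α₁) := by simp only [hα''_def, hD_def]; ring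
  have hα₁'' : α₁ ≤ α'' := by rw [hα''_def]; linarith only [h11]
  have h165 : 11 * (d : ℝ) ^ 2 * α₀ + α₁ ≤ α'' := by rw [hα''_def]; linarith only [h11']
  -- windows at the shifted pair
  obtain ⟨-, -, -, -, w5, w6, w7, w8, w9, w10, w11, w12, -, w14, -, -, -, -⟩ :=
    hw α₀ α'' hα₀ hα'' (hsum ▸ hsw) (5 * (d : ℝ) * L * B₀ * (α₀ + α'')) (8 * B₀' * (5 * (d : ℝ) * L * B₀) * (α₀ + α'')) rfl rfl
  obtain ⟨w19, -⟩ := hw' α₀ α'' hα₀ hα'' (hsum ▸ hsw')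
  have hsmall₁ : (d : ℝ) * L * α₁ ≤ 1 / 8 := (mul_le_mul_of_nonneg_left hα₁'' (by positivity)).trans w19
  have hα2 : 2 * α₀ ≤ c2' d L := by linarith only [w6, hα₀]
  -- the data
  obtain ⟨hP1, h34, hAx⟩ := hInAAx
  subst hP1
  -- (1.66)₀ on all bonds (Ω₀ = ℤᵈ): (1.65)
  have hpart' : ∀ x : Site d, ∃ j, j ≤ i.1.k ∧ ∃ y ∈ i.1.Λs i.1.k j, InBox (tlo L y j) (thi L y j) x := by
    intro x
    have hx : x ∈ i.1.Ω 0 := by rw [i.2]; trivial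
    exact i.1.hpart x hx
  have hsm : 11 * (d : ℝ) ^ 2 * α₀ + α₁ ≤ 1 / 6 := by linarith only [h165, hα₀, hsum, hs6]
  have h66 : ∀ b ∈ {b : Site d × Fin d | SideTouches (i.1.Ω 0) b.1 b.2}, ‖((P.2.1 b.1 b.2 : 𝔸ˣ) : 𝔸) - 1‖ ≤ α'' := by
    intro b _
    have h := norm_pert_sub_one_le_univ hd1 hL i.1.k (η := i.1.η) P.1.2 P.2.2 hα₀ w5 hα2 hα₁.le hsm
      i.1.Ω i.1.hΩ (i.1.Λs i.1.k) i.1.htower hpart' hInA h34 (hAx i.1.k le_rfl) havg b.1 b.2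
    exact h.trans h165
  have h166 : (zdGF3 𝔸 L β len i.1).avgClose166 α'' P.1 P :=
    ⟨fun j hj z μ hb => (havg j hj z μ hb).trans hα₁'', h66⟩
  -- THEOREM 4 at the shifted pair
  obtain ⟨u, hR, ⟨h137'', hLan, h162⟩, huniq⟩ :=
    H4 i.1 α₀ α'' hα₀ hα'' (hsum ▸ hs4) P.1 P hInA hReg ⟨rfl, h34, hAx⟩ h166
  -- (1.37) at the ORIGINAL α₁: the (1.42) lemma on the canonical exponent of the gauge-fixed field
  have hcs0 : 0 ≤ 5 * (d : ℝ) * L * B₀ * (α₀ + α'') := by positivity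
  have hKS0 : 0 ≤ 2 * (L * (5 * (d : ℝ) * L * B₀ * (α₀ + α''))) + 8 * (8 * B₀' * (5 * (d : ℝ) * L * B₀) * (α₀ + α'')) := by
    positivity
  have hcK : 5 * (d : ℝ) * L * B₀ * (α₀ + α'') ≤
      2 * (L * (5 * (d : ℝ) * L * B₀ * (α₀ + α''))) + 8 * (8 * B₀' * (5 * (d : ℝ) * L * B₀) * (α₀ + α'')) := by
    have h₁ : (1 : ℝ) * (5 * (d : ℝ) * L * B₀ * (α₀ + α'')) ≤ L * (5 * (d : ℝ) * L * B₀ * (α₀ + α'')) :=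
      mul_le_mul_of_nonneg_right hL' hcs0
    have h₂ : 0 ≤ 8 * (8 * B₀' * (5 * (d : ℝ) * L * B₀) * (α₀ + α'')) := by positivity
    linarith only [h₁, h₂, hcs0]
  have hc16 : 16 * (5 * (d : ℝ) * L * B₀ * (α₀ + α'')) ≤ 1 := by linarith only [w7, hcK, hKS0]
  have hu : ∀ x, u.1 x ∈ unitaryUnits 𝔸 := u.2.1
  have hW : mgauge P.1.1 u.1 (mgauge P.1.1 u.1⁻¹ P.2.1) = P.2.1 := mgauge_mgauge_inv P.1.1 P.2.1 u.1
  have hWu : ∀ x κ, mgauge P.1.1 u.1⁻¹ P.2.1 x κ ∈ unitaryUnits 𝔸 := mem_unitaryUnits_of_mgauge_eq P.1.2 P.2.2 hu hW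
  have hWA : ∀ j, j ≤ i.1.k → ∀ y τ, SideTouches (i.1.Ω j) y τ →
      mgauge P.1.1 u.1⁻¹ P.2.1 y τ = cfgExp i.1.η (logCfg i.1.η (mgauge P.1.1 u.1⁻¹ P.2.1)) y τ ∧
        ‖logCfg i.1.η (mgauge P.1.1 u.1⁻¹ P.2.1) y τ‖ ≤ (5 * (d : ℝ) * L * B₀ * (α₀ + α'')) * ((L : ℝ) ^ j * i.1.η)⁻¹ :=
    fun j hj y τ h => ⟨(h162 j hj (y, τ) h).1, (h162 j hj (y, τ) h).2.2⟩
  obtain ⟨hA'sa, hA'eq, hA'zero⟩ := mlogCfg_spec i.1.hη hL1 i.1.k P.1.1 hWu hcs0 hc16 i.1.Ω hWA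
  set A' := mlogCfg i.1.k i.1.η i.1.Ω (mgauge P.1.1 u.1⁻¹ P.2.1) with hA'_def
  have hA'bd : ∀ j, j ≤ i.1.k → ∀ y τ, SideTouches (i.1.Ω j) y τ →
      mgauge P.1.1 u.1⁻¹ P.2.1 y τ = cfgExp i.1.η A' y τ ∧
        ‖A' y τ‖ ≤ (2 * (L * (5 * (d : ℝ) * L * B₀ * (α₀ + α''))) + 8 * (8 * B₀' * (5 * (d : ℝ) * L * B₀) * (α₀ + α''))) *
          ((L : ℝ) ^ j * i.1.η)⁻¹ := by
    intro j hj y τ h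
    obtain ⟨hAA, hWexp⟩ := hA'eq j hj y τ h
    refine ⟨hWexp, ?_⟩
    rw [hAA]
    have hη0 : 0 ≤ i.1.η := i.1.hη.le
    exact ((hWA j hj y τ h).2).trans (mul_le_mul_of_nonneg_right hcK (by positivity))
  have h137 : (zdGF3 𝔸 L β len i.1).C137 α₁ P.1 ((zdGF3 𝔸 L β len i.1).act P u) :=
    B8Eq142KLevelLocal.H42_of_inAx hd2 i.1.hη hL i.1.k P.1.2 hα₀ hα₁ hKS0 w5 w6 w7 w9 w10 hsmall₁ i.1.Ω i.1.hΩ i.1.Λs i.1.Λb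
      i.1.hbox i.1.hclass hInA h34 hAx havg (fun m W => IsLandau138W L m i.1.η (i.1.Ω 0) (i.1.Λs m) P.1.1 W) i.1.k i.1.hk le_rfl u.1
      (mgauge P.1.1 u.1⁻¹ P.2.1) A' hu hW hR hLan hA'sa hA'bd hA'zero
  -- PROPOSITION 3 at (α₀, α″, α₂ := c⋆″) for the gauge-fixed field
  have hSD : α₀ + α₁ ≤ D * (α₀ + α₁) := le_mul_of_one_le_left hS0.le hD1
  have hα₀3 : α₀ ≤ c3 := by linarith only [hα₁, hSD, hs3]
  have hα''3 : α'' ≤ c3 := by linarith only [hα₀, hsum, hs3]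
  have hcs3 : 5 * (d : ℝ) * L * B₀ * (α₀ + α'') ≤ c3 := by
    rw [hsum, ← mul_assoc]; exact hs3'
  have hcspos : 0 < 5 * (d : ℝ) * L * B₀ * (α₀ + α'') := by positivity
  have h61 : 2 * (5 * (d : ℝ) * L * B₀ * (α₀ + α'')) ^ 2 + 20 * d * α₀ * (5 * (d : ℝ) * L * B₀ * (α₀ + α'')) +
      2 * (2097152 * ((d : ℝ) + 1) ^ 2) * (5 * (d : ℝ) * L * B₀ * (α₀ + α'')) ^ 2 ≤ α₀ + α'' := by
    set c := 5 * (d : ℝ) * L * B₀ * (α₀ + α'') with hc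
    set K := 2 * (L * c) + 8 * (8 * B₀' * (5 * (d : ℝ) * L * B₀) * (α₀ + α'')) with hK
    have hcKle : c ≤ K := hcK
    have hc0 : 0 ≤ c := hcs0
    have hC : (2 : ℝ) * (16 * (131072 * ((d : ℝ) + 1) ^ 2)) = 2 * (2097152 * ((d : ℝ) + 1) ^ 2) := by ring
    rw [← hC]
    have hmono : 2 * c ^ 2 + 20 * d * α₀ * c + 2 * (16 * (131072 * ((d : ℝ) + 1) ^ 2)) * c ^ 2 ≤
        2 * K ^ 2 + 20 * d * α₀ * K + 2 * (16 * (131072 * ((d : ℝ) + 1) ^ 2)) * K ^ 2 := by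
      have h1 : c ^ 2 ≤ K ^ 2 := pow_le_pow_left₀ hc0 hcKle 2
      have h2 : 0 ≤ 20 * (d : ℝ) * α₀ := by positivity
      have h3 : 0 ≤ 2 * (16 * (131072 * ((d : ℝ) + 1) ^ 2)) := by positivity
      have h4 := mul_le_mul_of_nonneg_left hcKle h2
      have h5 := mul_le_mul_of_nonneg_left h1 h3
      linarith only [h1, h4, h5]
    exact hmono.trans w14
  have hPair : (zdGF3 𝔸 L β len i.1).InAPair α₀ P.1 ((zdGF3 𝔸 L β len i.1).act P u) := by
    show InAk L i.1.k i.1.η α₀ i.1.Ω (mulCfg (mgauge P.1.1 u.1⁻¹ P.2.1) P.1.1)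
    have hui : ∀ x, u.1⁻¹ x ∈ U1 𝔸 := fun x => unitaryUnits_le_U1 ((unitaryUnits 𝔸).inv_mem (hu x))
    rw [mulCfg_eq_gaugeAct_of_mgauge_eq hW]
    exact (B8Ineq132.inAk_gaugeAct_iff L i.1.k i.1.η α₀ i.1.Ω hui _).2 h34
  have h162' : (zdGF3 𝔸 L β len i.1).C162 1 (5 * (d : ℝ) * L * B₀ * (α₀ + α'')) P.1 ((zdGF3 𝔸 L β len i.1).act P u) := by
    intro j hj b hb
    obtain ⟨h1, h2, h3⟩ := h162 j hj b hb
    exact ⟨h1, h2, by rw [one_mul]; exact h3⟩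
  obtain ⟨h136, h139⟩ := H3 i.1 α₀ α'' (5 * (d : ℝ) * L * B₀ * (α₀ + α'')) hα₀ hα₀3 hα'' hα''3 hcspos hcs3 h61 P.1
    ((zdGF3 𝔸 L β len i.1).act P u) hInA hReg hPair h162' hLan h137''
  -- constants: `5dLB₀(α₀ + α″) = B₁(α₀ + α₁)`, `5dL·B₀β·(α₀ + α″) = B₂(α₀ + α₁)`
  have e1 : 5 * (d : ℝ) * (L : ℝ) * inp.B₀ * (α₀ + α'') = B₁ * (α₀ + α₁) := by
    show 5 * (d : ℝ) * (L : ℝ) * B₀ * (α₀ + α'') = B₁ * (α₀ + α₁)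
    rw [hsum, hB₁_def]; ring
  have e2 : 5 * (d : ℝ) * (L : ℝ) * B₀β * (α₀ + α'') = B₂ * (α₀ + α₁) := by rw [hsum, hB₂_def]; ring
  obtain ⟨h136a, h136g, h136h⟩ := h136
  obtain ⟨h139j, h139l⟩ := h139
  refine ⟨u, hR, ⟨⟨fun j hj b hb => ?_, by rw [← e1]; exact h136g, by rw [← e2]; exact h136h⟩, h137, hLan,
    ⟨by rw [← e1]; exact h139j, by rw [← e1]; exact h139l⟩⟩, ?_⟩
  · obtain ⟨h1, h2, h3⟩ := h136a j hj b hb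
    exact ⟨h1, h2, by rw [← e1]; exact h3⟩
  -- uniqueness: Theorem 4's, since (1.36) at `B₁(α₀ + α₁) = B₁′(α₀ + α″)` is (1.62) there and (1.37) is monotone in α₁
  · intro u' hR' h136' h137' hLan' _
    refine huniq u' hR' ?_ hLan' ?_
    · intro j hj c hc
      have hmono : 2 * (d : ℝ) * L * α₁ ≤ 2 * d * L * α'' := mul_le_mul_of_nonneg_left hα₁'' (by positivity)
      exact (h137' j hj c hc).trans_le hmono
    · intro j hj b hb
      obtain ⟨h1, h2, h3⟩ := h136'.1 j hj b hb
      refine ⟨h1, h2, ?_⟩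
      have e1' : B₁ * (α₀ + α₁) = 5 * (d : ℝ) * L * B₀ * (α₀ + α'') := by rw [hsum, hB₁_def]; ring
      rw [← e1']
      exact h3

end Thm2

#print axioms thm2Printed_zd3_univ

end Literature.MathematicalPhysics.QuantumFieldTheory.Balaban1983to89.B8LeafModelZd3Thm2

end
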